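import Mathlib.Analysis.SpecificLimits.Basic
import Mathlib.Topology.MetricSpace.Basic
import Mathlib.Order.ConditionallyCompleteLattice.Basic
import HarnessLib

/-!
# Convergence from quasi-subadditivity under dilations (a Fekete-type lemma)

Topic `Literature/Analysis/Asymptotics`. The "standard subadditive argument" behind the existence of
flow / surface constants indexed by DILATES of a fixed base (Kesten 1987; Rossignol–Théret,
*Lower large deviations and laws of large numbers for maximal flows through a box in first passage
percolation*, Ann. IHP 46 (2010), Prop. 3.5 — the flow constant `ν(v) = lim E τ(nA, h(n)) / 𝓗^{d-1}(nA)`;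
Dembin 2020, Prop. 3.1): if `a : ℕ → ℝ` is non-decreasing (more base, more to cut) and the
normalised quantity `g(m) = a(m) / m^s` is **quasi-subadditive under dilations**,
`g(kn) ≤ g(n) + c/n` (`k^s` translates of the `n`-box tile the `kn`-box up to seams of lower order),
then `g(m)` converges, to `inf_{n ≥ 1} (g(n) + c/n)`. Compare Mathlib's `Subadditive.tendsto_lim`
(exact subadditivity `u(m+n) ≤ u(m) + u(n)`, limit `inf u(n)/n`); the present dilation form with an
error term is not in Mathlib.

* `le_ratio_pow_mul_of_dilation` — the one-step bound `g(m) ≤ ((k+1)/k)^s (g(n) + c/n)`,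
  `k = ⌊m/n⌋`, for `m ≥ n ≥ 1`;
* `tendsto_of_dilation_quasiSubadditive` — the convergence `g(m) → inf_{n ≥ 1} (g(n) + c/n)`.

Everything is folklore real analysis (`[folklore]` tags); the module docstring records the use.
-/

namespace Literature.Analysis.Asymptotics

open Filter
open scoped Topology

/-- **The one-step dilation bound.** If `m ↦ g(m) m^s` is non-decreasing (from `1` on) and
`g((k+1) n) ≤ g(n) + c/n`, then for `m ≥ n ≥ 1` and `k = ⌊m/n⌋`:
`g(m) ≤ ((k+1)/k)^s (g(n) + c/n)` — compare `m` with the next multiple `(k+1) n` of `n` and use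
`k n ≤ m`. [folklore] -/
theorem le_ratio_pow_mul_of_dilation {s : ℕ} {c : ℝ} (hc : 0 ≤ c) {g : ℕ → ℝ} (hg0 : ∀ n, 0 ≤ g n)
    (hmono : ∀ m m' : ℕ, 1 ≤ m → m ≤ m' → g m * (m : ℝ) ^ s ≤ g m' * (m' : ℝ) ^ s)
    (hsub : ∀ n k : ℕ, 1 ≤ n → 1 ≤ k → g (k * n) ≤ g n + c / n)
    {n m : ℕ} (hn : 1 ≤ n) (hnm : n ≤ m) :
    g m ≤ (((m / n + 1 : ℕ) : ℝ) / (m / n : ℕ)) ^ s * (g n + c / n) := by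
  set k := m / n with hk
  have hk1 : 1 ≤ k := Nat.div_pos hnm hn
  have hm1 : 1 ≤ m := hn.trans hnm
  have hm_lt : m < (k + 1) * n := by
    have := Nat.lt_mul_div_succ m hn
    rwa [mul_comm] at this
  have hkn_le : k * n ≤ m := Nat.div_mul_le_self m n
  have hgn : 0 ≤ g n + c / n := add_nonneg (hg0 n) (div_nonneg hc (Nat.cast_nonneg n))
  have hmpos : (0 : ℝ) < (m : ℝ) ^ s := pow_pos (by exact_mod_cast hm1) s
  -- `g m * m^s ≤ g((k+1)n) ((k+1)n)^s ≤ (g n + c/n) ((k+1)n)^s`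
  have hA : g m * (m : ℝ) ^ s ≤ (g n + c / n) * (((k + 1) * n : ℕ) : ℝ) ^ s :=
    (hmono m ((k + 1) * n) hm1 hm_lt.le).trans
      (mul_le_mul_of_nonneg_right (hsub n (k + 1) hn (by omega)) (pow_nonneg (Nat.cast_nonneg _) s))
  -- `((k+1) n)^s = ((k+1)/k)^s (k n)^s ≤ ((k+1)/k)^s m^s`
  have hk0 : ((k : ℕ) : ℝ) ≠ 0 := by exact_mod_cast (show k ≠ 0 by omega)
  have hsplit : (((k + 1) * n : ℕ) : ℝ) = (((k + 1 : ℕ) : ℝ) / (k : ℕ)) * ((k * n : ℕ) : ℝ) := by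
    push_cast
    field_simp
  have hB : (((k + 1) * n : ℕ) : ℝ) ^ s ≤ (((k + 1 : ℕ) : ℝ) / (k : ℕ)) ^ s * (m : ℝ) ^ s := by
    rw [hsplit, mul_pow]
    refine mul_le_mul_of_nonneg_left (pow_le_pow_left₀ (Nat.cast_nonneg _) (by exact_mod_cast hkn_le) s)
      (pow_nonneg (div_nonneg (Nat.cast_nonneg _) (Nat.cast_nonneg _)) s)
  have hC : g m * (m : ℝ) ^ s ≤ ((((k + 1 : ℕ) : ℝ) / (k : ℕ)) ^ s * (g n + c / n)) * (m : ℝ) ^ s :=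
    calc g m * (m : ℝ) ^ s ≤ (g n + c / n) * (((k + 1) * n : ℕ) : ℝ) ^ s := hA
      _ ≤ (g n + c / n) * ((((k + 1 : ℕ) : ℝ) / (k : ℕ)) ^ s * (m : ℝ) ^ s) :=
          mul_le_mul_of_nonneg_left hB hgn
      _ = ((((k + 1 : ℕ) : ℝ) / (k : ℕ)) ^ s * (g n + c / n)) * (m : ℝ) ^ s := by ring
  exact le_of_mul_le_mul_right hC hmpos

/-- **Convergence from quasi-subadditivity under dilations** (the subadditive argument for flow
constants along dilates, Kesten 1987 / Rossignol–Théret 2010 Prop. 3.5, abstract form). Let `g ≥ 0`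
with `m ↦ g(m) m^s` non-decreasing from `1` on and `g(k n) ≤ g(n) + c/n` for all `n, k ≥ 1`
(`c ≥ 0`). Then `g(m) → L := inf_{n ≥ 1} (g(n) + c/n)` as `m → ∞`: the lower bound is
`g(m) ≥ L - c/m`, the upper bound is the one-step dilation bound with `((k+1)/k)^s → 1`.
[folklore] -/
theorem tendsto_of_dilation_quasiSubadditive {s : ℕ} {c : ℝ} (hc : 0 ≤ c) {g : ℕ → ℝ}
    (hg0 : ∀ n, 0 ≤ g n)
    (hmono : ∀ m m' : ℕ, 1 ≤ m → m ≤ m' → g m * (m : ℝ) ^ s ≤ g m' * (m' : ℝ) ^ s)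
    (hsub : ∀ n k : ℕ, 1 ≤ n → 1 ≤ k → g (k * n) ≤ g n + c / n) :
    Tendsto g atTop (𝓝 (sInf {x : ℝ | ∃ n : ℕ, 1 ≤ n ∧ x = g n + c / n})) := by
  set S : Set ℝ := {x : ℝ | ∃ n : ℕ, 1 ≤ n ∧ x = g n + c / n} with hS
  have hSne : S.Nonempty := ⟨_, 1, le_rfl, rfl⟩
  have hnonneg : ∀ x ∈ S, 0 ≤ x := by
    rintro x ⟨n, -, rfl⟩
    exact add_nonneg (hg0 n) (div_nonneg hc (Nat.cast_nonneg n))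
  have hSbdd : BddBelow S := ⟨0, hnonneg⟩
  set L := sInf S with hL
  have hLle : ∀ n : ℕ, 1 ≤ n → L ≤ g n + c / n := fun n hn => csInf_le hSbdd ⟨n, hn, rfl⟩
  rw [Metric.tendsto_atTop]
  intro ε hε
  -- a good scale `n`: `g n + c/n < L + ε/2`
  obtain ⟨x, ⟨n, hn, rfl⟩, hx⟩ := exists_lt_of_csInf_lt hSne (show L < L + ε / 2 by linarith)
  -- `((k+1)/k)^s (g n + c/n) → g n + c/n < L + ε`
  have hratio : Tendsto (fun k : ℕ => (((k + 1 : ℕ) : ℝ) / (k : ℕ))) atTop (𝓝 1) := by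
    have heq : (fun k : ℕ => (((k + 1 : ℕ) : ℝ) / (k : ℕ))) =ᶠ[atTop] fun k : ℕ => 1 + 1 / (k : ℝ) := by
      filter_upwards [eventually_ge_atTop 1] with k hk
      have hk0 : (k : ℝ) ≠ 0 := by exact_mod_cast (show k ≠ 0 by omega)
      push_cast
      field_simp
    rw [tendsto_congr' heq]
    simpa using (tendsto_one_div_atTop_nhds_zero_nat).const_add (1 : ℝ)
  have hlim : Tendsto (fun k : ℕ => (((k + 1 : ℕ) : ℝ) / (k : ℕ)) ^ s * (g n + c / n)) atTop
      (𝓝 (g n + c / n)) := by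
    simpa using (hratio.pow s).mul_const (g n + c / n)
  obtain ⟨K, hK⟩ := eventually_atTop.1 (hlim.eventually (gt_mem_nhds (show g n + c / n < L + ε by
    linarith)))
  -- a scale beyond which `c/m < ε`
  obtain ⟨M₁, hM₁⟩ := exists_nat_gt (c / ε)
  refine ⟨max (max K 1 * n) (M₁ + 1), fun m hm => ?_⟩
  have hm1 : max K 1 * n ≤ m := le_trans (le_max_left _ _) hm
  have hm2 : M₁ + 1 ≤ m := le_trans (le_max_right _ _) hm
  have hnm : n ≤ m := le_trans (Nat.le_mul_of_pos_left n (lt_of_lt_of_le Nat.one_pos (le_max_right K 1))) hm1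
  have hkK : K ≤ m / n :=
    (Nat.le_div_iff_mul_le hn).2 (le_trans (Nat.mul_le_mul_right n (le_max_left K 1)) hm1)
  rw [Real.dist_eq, abs_sub_lt_iff]
  constructor
  · -- upper bound through the scale `n`
    have h1 := le_ratio_pow_mul_of_dilation hc hg0 hmono hsub hn hnm
    have h2 := hK (m / n) hkK
    linarith
  · -- lower bound `L ≤ g m + c/m` with `c/m < ε`
    have hm0 : (0 : ℝ) < m := by exact_mod_cast (show 0 < m by omega)
    have h1 := hLle m (by omega)
    have h2 : c / m < ε := by
      rw [div_lt_iff₀ hm0]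
      have hM : (M₁ : ℝ) ≤ m := by exact_mod_cast (show M₁ ≤ m by omega)
      calc c = c / ε * ε := by field_simp
        _ < (M₁ : ℝ) * ε := mul_lt_mul_of_pos_right hM₁ hε
        _ ≤ (m : ℝ) * ε := mul_le_mul_of_nonneg_right hM hε.le
        _ = ε * m := mul_comm _ _
    linarith

end Literature.Analysis.Asymptotics

/-! ## Variant: monotonicity up to a lower-order defect -/

namespace Literature.Analysis.Asymptotics

open Filter
open scoped Topology

/-- **One-step dilation bound with a monotonicity defect**: if `g(m) m^s ≤ g(m') m'^s + c' m^{s-1}`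
for `1 ≤ m ≤ m'` (`s ≥ 1`) and `g(k n) ≤ g(n) + c/n`, then for `m ≥ n ≥ 1`, `k = ⌊m/n⌋`:
`g(m) ≤ ((k+1)/k)^s (g(n) + c/n) + c'/m`. [folklore] -/
theorem le_ratio_pow_mul_of_dilation' {s : ℕ} (hs : 1 ≤ s) {c c' : ℝ} (hc : 0 ≤ c)
    {g : ℕ → ℝ} (hg0 : ∀ n, 0 ≤ g n)
    (hmono : ∀ m m' : ℕ, 1 ≤ m → m ≤ m' →
      g m * (m : ℝ) ^ s ≤ g m' * (m' : ℝ) ^ s + c' * (m : ℝ) ^ (s - 1))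
    (hsub : ∀ n k : ℕ, 1 ≤ n → 1 ≤ k → g (k * n) ≤ g n + c / n)
    {n m : ℕ} (hn : 1 ≤ n) (hnm : n ≤ m) :
    g m ≤ (((m / n + 1 : ℕ) : ℝ) / (m / n : ℕ)) ^ s * (g n + c / n) + c' / m := by
  set k := m / n with hk
  have hk1 : 1 ≤ k := Nat.div_pos hnm hn
  have hm1 : 1 ≤ m := hn.trans hnm
  have hm_lt : m < (k + 1) * n := by
    have := Nat.lt_mul_div_succ m hn
    rwa [mul_comm] at this
  have hkn_le : k * n ≤ m := Nat.div_mul_le_self m n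
  have hgn : 0 ≤ g n + c / n := add_nonneg (hg0 n) (div_nonneg hc (Nat.cast_nonneg n))
  have hm0 : (0 : ℝ) < m := by exact_mod_cast hm1
  have hmpos : (0 : ℝ) < (m : ℝ) ^ s := pow_pos hm0 s
  have hms : (m : ℝ) ^ s = (m : ℝ) ^ (s - 1) * m := by
    rw [← pow_succ]; congr 1; omega
  have hA : g m * (m : ℝ) ^ s ≤ (g n + c / n) * (((k + 1) * n : ℕ) : ℝ) ^ s + c' * (m : ℝ) ^ (s - 1) :=
    (hmono m ((k + 1) * n) hm1 hm_lt.le).trans (add_le_add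
      (mul_le_mul_of_nonneg_right (hsub n (k + 1) hn (by omega)) (pow_nonneg (Nat.cast_nonneg _) s)) le_rfl)
  have hk0 : ((k : ℕ) : ℝ) ≠ 0 := by exact_mod_cast (show k ≠ 0 by omega)
  have hsplit : (((k + 1) * n : ℕ) : ℝ) = (((k + 1 : ℕ) : ℝ) / (k : ℕ)) * ((k * n : ℕ) : ℝ) := by
    push_cast
    field_simp
  have hB : (((k + 1) * n : ℕ) : ℝ) ^ s ≤ (((k + 1 : ℕ) : ℝ) / (k : ℕ)) ^ s * (m : ℝ) ^ s := by
    rw [hsplit, mul_pow]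
    exact mul_le_mul_of_nonneg_left (pow_le_pow_left₀ (Nat.cast_nonneg _) (by exact_mod_cast hkn_le) s)
      (pow_nonneg (div_nonneg (Nat.cast_nonneg _) (Nat.cast_nonneg _)) s)
  have hC : g m * (m : ℝ) ^ s ≤
      ((((k + 1 : ℕ) : ℝ) / (k : ℕ)) ^ s * (g n + c / n) + c' / m) * (m : ℝ) ^ s :=
    calc g m * (m : ℝ) ^ s
        ≤ (g n + c / n) * (((k + 1) * n : ℕ) : ℝ) ^ s + c' * (m : ℝ) ^ (s - 1) := hA
      _ ≤ (g n + c / n) * ((((k + 1 : ℕ) : ℝ) / (k : ℕ)) ^ s * (m : ℝ) ^ s) + c' * (m : ℝ) ^ (s - 1) :=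
          add_le_add (mul_le_mul_of_nonneg_left hB hgn) le_rfl
      _ = ((((k + 1 : ℕ) : ℝ) / (k : ℕ)) ^ s * (g n + c / n) + c' / m) * (m : ℝ) ^ s := by
          rw [add_mul, hms]
          field_simp
  exact le_of_mul_le_mul_right hC hmpos

/-- **Convergence from quasi-subadditivity under dilations, with a monotonicity defect**: under
the hypotheses of `le_ratio_pow_mul_of_dilation'` (`g ≥ 0`, `s ≥ 1`, `c, c' ≥ 0`),
`g(m) → inf_{n ≥ 1} (g(n) + c/n)`. This is the form needed when the underlying quantity is only
monotone up to a boundary term (pinned min-cuts of nested straight cylinders). [folklore] -/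
theorem tendsto_of_dilation_quasiSubadditive' {s : ℕ} (hs : 1 ≤ s) {c c' : ℝ} (hc : 0 ≤ c)
    (hc' : 0 ≤ c') {g : ℕ → ℝ} (hg0 : ∀ n, 0 ≤ g n)
    (hmono : ∀ m m' : ℕ, 1 ≤ m → m ≤ m' →
      g m * (m : ℝ) ^ s ≤ g m' * (m' : ℝ) ^ s + c' * (m : ℝ) ^ (s - 1))
    (hsub : ∀ n k : ℕ, 1 ≤ n → 1 ≤ k → g (k * n) ≤ g n + c / n) :
    Tendsto g atTop (𝓝 (sInf {x : ℝ | ∃ n : ℕ, 1 ≤ n ∧ x = g n + c / n})) := by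
  set S : Set ℝ := {x : ℝ | ∃ n : ℕ, 1 ≤ n ∧ x = g n + c / n} with hS
  have hSne : S.Nonempty := ⟨_, 1, le_rfl, rfl⟩
  have hnonneg : ∀ x ∈ S, 0 ≤ x := by
    rintro x ⟨n, -, rfl⟩
    exact add_nonneg (hg0 n) (div_nonneg hc (Nat.cast_nonneg n))
  have hSbdd : BddBelow S := ⟨0, hnonneg⟩
  set L := sInf S with hL
  have hLle : ∀ n : ℕ, 1 ≤ n → L ≤ g n + c / n := fun n hn => csInf_le hSbdd ⟨n, hn, rfl⟩
  rw [Metric.tendsto_atTop]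
  intro ε hε
  obtain ⟨x, ⟨n, hn, rfl⟩, hx⟩ := exists_lt_of_csInf_lt hSne (show L < L + ε / 3 by linarith)
  have hratio : Tendsto (fun k : ℕ => (((k + 1 : ℕ) : ℝ) / (k : ℕ))) atTop (𝓝 1) := by
    have heq : (fun k : ℕ => (((k + 1 : ℕ) : ℝ) / (k : ℕ))) =ᶠ[atTop] fun k : ℕ => 1 + 1 / (k : ℝ) := by
      filter_upwards [eventually_ge_atTop 1] with k hk
      have hk0 : (k : ℝ) ≠ 0 := by exact_mod_cast (show k ≠ 0 by omega)
      push_cast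
      field_simp
    rw [tendsto_congr' heq]
    simpa using (tendsto_one_div_atTop_nhds_zero_nat).const_add (1 : ℝ)
  have hlim : Tendsto (fun k : ℕ => (((k + 1 : ℕ) : ℝ) / (k : ℕ)) ^ s * (g n + c / n)) atTop
      (𝓝 (g n + c / n)) := by
    simpa using (hratio.pow s).mul_const (g n + c / n)
  obtain ⟨K, hK⟩ := eventually_atTop.1 (hlim.eventually (gt_mem_nhds (show g n + c / n < L + ε / 3 by
    linarith)))
  obtain ⟨M₁, hM₁⟩ := exists_nat_gt ((c + c') / (ε / 3))
  refine ⟨max (max K 1 * n) (M₁ + 1), fun m hm => ?_⟩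
  have hm1 : max K 1 * n ≤ m := le_trans (le_max_left _ _) hm
  have hm2 : M₁ + 1 ≤ m := le_trans (le_max_right _ _) hm
  have hnm : n ≤ m := le_trans (Nat.le_mul_of_pos_left n (lt_of_lt_of_le Nat.one_pos (le_max_right K 1))) hm1
  have hkK : K ≤ m / n :=
    (Nat.le_div_iff_mul_le hn).2 (le_trans (Nat.mul_le_mul_right n (le_max_left K 1)) hm1)
  have hm0 : (0 : ℝ) < m := by exact_mod_cast (show 0 < m by omega)
  -- `c/m, c'/m < ε/3`
  have hsmall : (c + c') / m < ε / 3 := by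
    rw [div_lt_iff₀ hm0]
    have hM : (M₁ : ℝ) ≤ m := by exact_mod_cast (show M₁ ≤ m by omega)
    have hε3 : (0 : ℝ) < ε / 3 := by linarith
    calc c + c' = (c + c') / (ε / 3) * (ε / 3) := by field_simp
      _ < (M₁ : ℝ) * (ε / 3) := mul_lt_mul_of_pos_right hM₁ hε3
      _ ≤ (m : ℝ) * (ε / 3) := mul_le_mul_of_nonneg_right hM hε3.le
      _ = ε / 3 * m := mul_comm _ _
  have hcm : c / m ≤ (c + c') / m := div_le_div_of_nonneg_right (by linarith) hm0.le
  have hc'm : c' / m ≤ (c + c') / m := div_le_div_of_nonneg_right (by linarith) hm0.le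
  rw [Real.dist_eq, abs_sub_lt_iff]
  constructor
  · have h1 := le_ratio_pow_mul_of_dilation' hs hc hg0 hmono hsub hn hnm
    have h2 := hK (m / n) hkK
    linarith
  · have h1 := hLle m (by omega)
    linarith

end Literature.Analysis.Asymptotics
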